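import Literature.AlgebraicGeometry.Motives.ProjectiveOfGeneratingSections
import HarnessLib

/-!
# The projective morphism defined by a family of sections of `𝓛^{⊗N}` together with the `s_i^{⊗2N}`

Let `D : GeneratingSections ι Y` be generating-sections data (`Motives/MorphismsToProjectiveSpace`: charts `U i = Y_{s_i}`,
ratios `s_j/s_i`) over a field `k`, and let `τ i l ∈ Γ(Y, 𝓛^{⊗N})` (`GeneratingSections.Sec`, chart form), `l ∈ L i`, be
finitely many sections attached to "home charts" `i`. This file generalises the construction `GeneratingSections.embData` of
`Motives/ProjectiveOfGeneratingSections` (where the `τ i l` are extensions of `k`-algebra generators of the `Γ(Y, U i)`,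
Görtz–Wedhorn I, proof of Thm. 13.59 / Hartshorne II, proof of Thm. 7.6) to an ARBITRARY such family:

* `famSec`, `famNewSec`, `famData` — the sections `σ(i, none) = s_i^{⊗2N}`, `σ(i, some l) = τ i l ⊗ s_i^{⊗N}` of `𝓛^{⊗2N}` and
  the generating-sections data they define (`GeneratingSections.ofSections`); `famData_U_none : U (i, none) = U i`,
  `famData_ratio_none` (the ratios at the charts `(i, none)` are the home values of the `σ m`), `isAffineOpen_famData_U`;
* `closure_famData_none` — if `k` and the home values `(τ i l)/s_i^N`, `l ∈ L i`, generate `Γ(Y, U i)`, the chart ring map at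
  `(i, none)` is surjective (Hartshorne II Prop. 7.2, hypothesis (2));
* `isClosedImmersion_toProj_famData` — then, for `Y → Spec k` universally closed and any reindexing `Fin (n+1) ≃ Σ i, Option (L i)`,
  the morphism `Y → ℙⁿ_k` defined by these sections is a CLOSED IMMERSION (Hartshorne II Prop. 7.2 over the charts `D₊(x_{(i,none)})`,
  which cover the image; the image is closed).

Everything is proved; no named facts. Used by the crux `EquisingularLift` of `Summits/ResolutionOfSingularities` (re-embedding a
projective scheme so that a given ideal sheaf becomes the restriction of a coordinate linear subspace).

## References

* R. Hartshorne, *Algebraic Geometry*, GTM 52 (1977): II Lemma 5.14, Thm. 7.1, Prop. 7.2, Thm. 7.6. [Hartshorne1977]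
* U. Görtz, T. Wedhorn, *Algebraic Geometry I*, 2nd ed. (2020): Thm. 13.59 (proof), Prop. 13.47. [GortzWedhorn2020]
-/

universe u

open CategoryTheory AlgebraicGeometry Limits HomogeneousLocalization TopologicalSpace Opposite
open MvPolynomial (X C)
open Literature.AlgebraicGeometry.Motives.Segre

attribute [local instance] MvPolynomial.gradedAlgebra

noncomputable section

namespace Literature.AlgebraicGeometry.Motives

namespace GeneratingSections

variable {ι : Type} {Y : Scheme.{u}} (D : GeneratingSections ι Y) {N : ℕ} (hN : 0 < N) (L : ι → Type)
  (τ : ∀ i, L i → D.Sec N)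

/-! ### The sections `s_i^{⊗2N}` and `τ i l ⊗ s_i^{⊗N}` -/

/-- The index type of the family: `(i, none)` for `s_i^{⊗2N}` and `(i, some l)` for `τ i l ⊗ s_i^{⊗N}`. [cite: Hartshorne1977, II Thm. 7.1] -/
abbrev FIndex : Type := Σ i : ι, Option (L i)

/-- The degree-`N` part: `s_i^{⊗N}` for `(i, none)`, `τ i l` for `(i, some l)`. [cite: GortzWedhorn2020, Thm. 13.59 (proof)] -/
def famSec : FIndex L → D.Sec N
  | ⟨i, none⟩ => Sec.pow D i N
  | ⟨i, some l⟩ => τ i l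

/-- The sections `σ m = famSec m ⊗ s_i^{⊗N}` of `𝓛^{⊗2N}`, `i` the home chart of `m`. [cite: GortzWedhorn2020, Thm. 13.59 (proof)] -/
def famNewSec (m : FIndex L) : D.Sec (N + N) :=
  (D.famSec L τ m).mul (Sec.pow D m.1 N)

/-- On the home chart, `famSec (i, none)` has value `1`. [cite: Hartshorne1977, II Thm. 7.1] -/
theorem famSec_val_none (i : ι) : (D.famSec L τ ⟨i, none⟩).val i = 1 := by
  simp only [famSec, Sec.pow_val, D.ratio_self, one_pow]

/-- `famSec (i, some l) = τ i l`. [cite: Hartshorne1977, II Thm. 7.1] -/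
theorem famSec_some (i : ι) (l : L i) : D.famSec L τ ⟨i, some l⟩ = τ i l := rfl

/-- The chart values of `σ m`: `(σ m)/s_j^{2N} = (famSec m)/s_j^N · (s_{m.1}/s_j)^N`. [cite: Hartshorne1977, II Thm. 7.1] -/
theorem famNewSec_val (m : FIndex L) (j : ι) :
    (D.famNewSec L τ m).val j = (D.famSec L τ m).val j * D.ratio j m.1 ^ N := by
  simp only [famNewSec, Sec.mul_val, Sec.pow_val]

/-- The home-chart value of `σ m` is that of `famSec m`. [cite: Hartshorne1977, II Thm. 7.1] -/
theorem famNewSec_val_home (m : FIndex L) : (D.famNewSec L τ m).val m.1 = (D.famSec L τ m).val m.1 := by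
  rw [famNewSec_val, D.ratio_self, one_pow, mul_one]

include hN in
/-- Each `σ m` is supported in its home chart: `Y_{σ m} ⊆ U i` for `m = (i, _)`. [cite: GortzWedhorn2020, Thm. 13.59 (proof)] -/
theorem famNewSec_home (m : FIndex L) (j : ι) : Y.basicOpen ((D.famNewSec L τ m).val j) ≤ D.U m.1 := by
  rw [famNewSec_val, Y.basicOpen_mul, Y.basicOpen_pow _ hN]
  exact inf_le_right.trans (D.V_le_right j m.1)

/-- The non-vanishing locus of `σ (i, none) = s_i^{⊗2N}` is `U i`. [cite: Hartshorne1977, II Thm. 7.1] -/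
theorem basicOpen_famNewSec_none (i : ι) : Y.basicOpen ((D.famNewSec L τ ⟨i, none⟩).val i) = D.U i := by
  rw [famNewSec_val_home, famSec_val_none, Y.basicOpen_one]

/-- The sections have no common zero (already the `s_i^{⊗2N}` do not). [cite: Hartshorne1977, II Thm. 7.1] -/
theorem iSup_basicOpen_famNewSec : ⨆ m : FIndex L, Y.basicOpen ((D.famNewSec L τ m).val m.1) = ⊤ := by
  rw [← top_le_iff, ← D.iSup_U, iSup_le_iff]
  intro i
  rw [← D.basicOpen_famNewSec_none L τ i]
  exact le_iSup (fun m : FIndex L ↦ Y.basicOpen ((D.famNewSec L τ m).val m.1)) ⟨i, none⟩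

/-! ### The generating-sections data of the family -/

/-- **The generating-sections data of `𝓛^{⊗2N}` defined by the sections `s_i^{⊗2N}` and `τ i l ⊗ s_i^{⊗N}`**
(`GeneratingSections.ofSections`). [cite: GortzWedhorn2020, Thm. 13.59 (proof)] -/
def famData : GeneratingSections (FIndex L) Y :=
  D.ofSections Sigma.fst (D.famNewSec L τ) (D.famNewSec_home hN L τ) (D.iSup_basicOpen_famNewSec L τ)

/-- The opens of `famData` are the `Y_{σ m}`. [cite: Hartshorne1977, II Thm. 7.1] -/
theorem famData_U (m : FIndex L) : (D.famData hN L τ).U m = Y.basicOpen ((D.famNewSec L τ m).val m.1) := rfl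

/-- All opens of `famData` are affine when the `U i` are (basic opens of affines). [cite: GortzWedhorn2020, Prop. 13.47] -/
theorem isAffineOpen_famData_U (hU : ∀ i, IsAffineOpen (D.U i)) (m : FIndex L) : IsAffineOpen ((D.famData hN L τ).U m) :=
  (hU m.1).basicOpen _

/-- The open of `famData` at `(i, none)` is `U i`. [cite: Hartshorne1977, II Thm. 7.1] -/
theorem famData_U_none (i : ι) : (D.famData hN L τ).U ⟨i, none⟩ = D.U i :=
  D.basicOpen_famNewSec_none L τ i

/-- **The ratios at the charts `(i, none)`**: `σ m' / s_i^{2N}` on `U i` is the `i`-th chart value of `σ m'`, i.e.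
`(famSec m')/s_i^N · (s_{i'}/s_i)^N` for `m' = (i', _)`. [cite: Hartshorne1977, II Thm. 7.1] -/
theorem famData_ratio_none (i : ι) (m' : FIndex L) :
    (D.famData hN L τ).ratio ⟨i, none⟩ m' = rs (le_of_eq (D.famData_U_none hN L τ i)) ((D.famNewSec L τ m').val i) := by
  have h := D.ratio'_mul_num Sigma.fst (D.famNewSec L τ) ⟨i, none⟩ m'
  rw [num, famNewSec_val_home, famSec_val_none, map_one, mul_one] at h
  exact h

/-- In particular `σ (i, some l) / s_i^{2N} = (τ i l)/s_i^N` on `U i`. [cite: Hartshorne1977, II Thm. 7.1] -/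
theorem famData_ratio_none_some (i : ι) (l : L i) :
    (D.famData hN L τ).ratio ⟨i, none⟩ ⟨i, some l⟩ = rs (le_of_eq (D.famData_U_none hN L τ i)) ((τ i l).val i) := by
  rw [famData_ratio_none, famNewSec_val_home, famSec_some]

section Field

variable {k : Type u} [Field k] (f : Y ⟶ Spec (.of k))

/-- At the chart `(i, none)` the constants of `famData` are those of `U i` restricted along `Y_{s_i^{2N}} = U i`. [cite: Hartshorne1977, II Thm. 7.1] -/
theorem famData_cstr_none (i : ι) (c : k) :
    (D.famData hN L τ).cstr f ⟨i, none⟩ c = rs (le_of_eq (D.famData_U_none hN L τ i)) (D.cstr f i c) := by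
  simp only [cstr, RingHom.comp_apply, rs_rs]

/-- **Surjectivity at the charts `(i, none)`** (Hartshorne II Prop. 7.2, hypothesis (2)): if `k` and the home values
`(τ i l)/s_i^N` generate `Γ(Y, U i)`, then `k` and the ratios at `m = (i, none)` generate `Γ(Y, Y_{s_i^{2N}})`. [cite: Hartshorne1977, II Prop. 7.2] -/
theorem closure_famData_none (m : FIndex L) (hm : m.2 = none)
    (hgen : Subring.closure (Set.range (D.cstr f m.1) ∪ Set.range (fun l : L m.1 => (τ m.1 l).val m.1)) = ⊤) :
    Subring.closure (Set.range ((D.famData hN L τ).cstr f m) ∪ Set.range ((D.famData hN L τ).ratio m)) = ⊤ := by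
  -- adapted from `GeneratingSections.closure_embData_none`
  obtain ⟨i, o⟩ := m
  cases o with
  | some _ => exact absurd hm (by simp)
  | none =>
    set θ : Γ(Y, D.U i) →+* Γ(Y, (D.famData hN L τ).U ⟨i, none⟩) :=
      rs (le_of_eq (D.famData_U_none hN L τ i)) with hθ
    have hθsurj : Function.Surjective θ := by
      intro s
      refine ⟨rs (le_of_eq (D.famData_U_none hN L τ i).symm) s, ?_⟩
      rw [hθ, rs_rs, rs_refl]
    have hsub : θ '' (Set.range (D.cstr f i) ∪ Set.range (fun l : L i => (τ i l).val i)) ⊆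
        Set.range ((D.famData hN L τ).cstr f ⟨i, none⟩) ∪ Set.range ((D.famData hN L τ).ratio ⟨i, none⟩) := by
      rintro _ ⟨s, hs | hs, rfl⟩
      · obtain ⟨c, rfl⟩ := hs
        exact Or.inl ⟨c, D.famData_cstr_none hN L τ f i c⟩
      · obtain ⟨l, rfl⟩ := hs
        exact Or.inr ⟨⟨i, some l⟩, D.famData_ratio_none_some hN L τ i l⟩
    rw [← top_le_iff]
    calc (⊤ : Subring _) = θ.range := (RingHom.range_eq_top.mpr hθsurj).symm
      _ = (Subring.closure (Set.range (D.cstr f i) ∪ Set.range (fun l : L i => (τ i l).val i))).map θ := by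
          rw [hgen, ← RingHom.range_eq_map]
      _ = Subring.closure (θ '' (Set.range (D.cstr f i) ∪ Set.range (fun l : L i => (τ i l).val i))) :=
          RingHom.map_closure _ _
      _ ≤ _ := Subring.closure_mono hsub

/-- After reindexing by `Fin (n + 1)`, the preimages of the charts `D₊(x_a)` with `a ↔ (i, none)` are the `U i`, so they cover
`Y`. [cite: Hartshorne1977, II Prop. 7.2] -/
theorem iSup_preimage_chart_famData_none {n : ℕ} (e : Fin (n + 1) ≃ FIndex L) :
    ⨆ a : {a : Fin (n + 1) // ∃ i, e a = ⟨i, none⟩},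
      ((D.famData hN L τ).reindex e).toProj f ⁻¹ᵁ Proj.basicOpen (grading (Fin (n + 1)) k) (X a.1) = ⊤ := by
  -- adapted from `GeneratingSections.iSup_preimage_chart_none`
  rw [← top_le_iff, ← D.iSup_U, iSup_le_iff]
  intro i
  let a : {a : Fin (n + 1) // ∃ i, e a = ⟨i, none⟩} := ⟨e.symm ⟨i, none⟩, i, e.apply_symm_apply _⟩
  refine le_trans (le_of_eq ?_) (le_iSup (fun a : {a : Fin (n + 1) // ∃ i, e a = ⟨i, none⟩} ↦
    ((D.famData hN L τ).reindex e).toProj f ⁻¹ᵁ Proj.basicOpen (grading (Fin (n + 1)) k) (X a.1)) a)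
  rw [toProj_preimage_basicOpen, reindex_U, Equiv.apply_symm_apply, famData_U_none]

/-- Over a chart `D₊(x_a)` with `a ↔ (i, none)`, the morphism to `ℙⁿ` is a closed immersion when `U i` is affine and `k` with
the home values generate `Γ(Y, U i)` (Hartshorne II Prop. 7.2 for these charts). [cite: Hartshorne1977, II Prop. 7.2] -/
theorem isClosedImmersion_restrict_chart_famData_none (hU : ∀ i, IsAffineOpen (D.U i))
    (hgen : ∀ i, Subring.closure (Set.range (D.cstr f i) ∪ Set.range (fun l : L i => (τ i l).val i)) = ⊤)
    {n : ℕ} (e : Fin (n + 1) ≃ FIndex L) (a : Fin (n + 1)) (ha : ∃ i, e a = ⟨i, none⟩) :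
    IsClosedImmersion (((D.famData hN L τ).reindex e).toProj f ∣_ Proj.basicOpen (grading (Fin (n + 1)) k) (X a)) := by
  -- adapted from `GeneratingSections.isClosedImmersion_restrict_chart_none`
  refine ((D.famData hN L τ).reindex e).isClosedImmersion_toProj_restrict f a
    (D.isAffineOpen_famData_U hN L τ hU (e a))
    (((D.famData hN L τ).reindex e).sectionsRingHom_surjective_of_closure_eq_top f a ?_)
  have hr : Set.range (((D.famData hN L τ).reindex e).ratio a) = Set.range ((D.famData hN L τ).ratio (e a)) := by
    change Set.range (fun b ↦ (D.famData hN L τ).ratio (e a) (e b)) = _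
    exact e.surjective.range_comp ((D.famData hN L τ).ratio (e a))
  have hm : (e a).2 = none := by
    obtain ⟨i, hi⟩ := ha
    rw [hi]
  rw [hr]
  exact D.closure_famData_none hN L τ f (e a) hm (hgen (e a).1)

/-- **The morphism `Y → ℙⁿ_k` defined by the sections `s_i^{⊗2N}`, `τ i l ⊗ s_i^{⊗N}` is a closed immersion** when the `U i`
are affine, `k` and the home values `(τ i l)/s_i^N` generate each `Γ(Y, U i)`, and `Y → Spec k` is universally closed
(Hartshorne II Prop. 7.2 over the charts `D₊(x_{(i,none)})` — which cover the image — and closedness of the image).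
[cite: Hartshorne1977, II Prop. 7.2] -/
theorem isClosedImmersion_toProj_famData [UniversallyClosed f] (hU : ∀ i, IsAffineOpen (D.U i))
    (hgen : ∀ i, Subring.closure (Set.range (D.cstr f i) ∪ Set.range (fun l : L i => (τ i l).val i)) = ⊤)
    {n : ℕ} (e : Fin (n + 1) ≃ FIndex L) :
    IsClosedImmersion (((D.famData hN L τ).reindex e).toProj f) := by
  -- adapted from `GeneratingSections.isProjectiveOver_of_isAffineOpen`
  refine isClosedImmersion_of_restrict (((D.famData hN L τ).reindex e).toProj f)
    (κ := {a : Fin (n + 1) // ∃ i, e a = ⟨i, none⟩})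
    (fun a ↦ Proj.basicOpen (grading (Fin (n + 1)) k) (X a.1))
    (D.iSup_preimage_chart_famData_none hN L τ f e)
    (fun a ↦ D.isClosedImmersion_restrict_chart_famData_none hN L τ f hU hgen e a.1 a.2) ?_
  have h1 : UniversallyClosed (((D.famData hN L τ).reindex e).toProj f ≫ toSpec (Fin (n + 1)) k) := by
    rw [toProj_toSpec]
    infer_instance
  have h2 : IsSeparated (toSpec (Fin (n + 1)) k) := by
    unfold toSpec
    infer_instance
  have h3 : UniversallyClosed (((D.famData hN L τ).reindex e).toProj f) :=
    .of_comp_of_isSeparated _ (toSpec (Fin (n + 1)) k)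
  exact (((D.famData hN L τ).reindex e).toProj f).isClosedMap.isClosed_range

end Field

end GeneratingSections

end Literature.AlgebraicGeometry.Motives

end
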